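import Literature.NumberTheory.LFunctions.DworkRationalityOverconvergentProofs
import Mathlib.RingTheory.RootsOfUnity.AlgebraicallyClosed
import Mathlib.RingTheory.IntegralDomain
import HarnessLib

/-!
# Dwork's trace formula: the character-sum half (Koblitz, Ch. V §3, Lemma 3)

Part of the bottom-up proof of Dwork's rationality theorem
(`Literature/NumberTheory/LFunctions/DworkRationality.lean`), towards the named fact
`Dwork.dworkFredholm` of `…/DworkRationalityMeromorphy.lean`. Koblitz's Lemma 3 (GTM 58, p. 129)
states `(qˢ - 1)ⁿ Tr(Ψˢ) = ∑_{x^{qˢ-1}=1} G(x) G(x^q) ⋯ G(x^{q^{s-1}})` for `G ∈ R₀`,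
`Ψ = T_q ∘ G`; its proof has two halves:

* the operator-theoretic half `Tr(Ψ) = ∑_u g_{(q-1)u}` and `Ψˢ = Ψ_{qˢ, G G_q ⋯ G_{q^{s-1}}}`
  (infinite matrices; not in this file), and
* the **character-sum half**, proved here as
  `Literature.NumberTheory.LFunctions.Dwork.sum_evalAt_rootsOfUnity`: for `H ∈ R₀` and `N ≥ 1`,
  `∑_{x ∈ μ_N^ι} H(x) = N^{#ι} ∑_u h_{N u}` (Koblitz: "`∑_{x^{q-1}=1} x^w = (q-1)ⁿ` if `q - 1`
  divides `w`, `0` otherwise", Ex. 6 of §4), together with the resulting expression of the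
  trace numbers of `…/DworkRationalityMeromorphy.lean` as coefficient sums,
  `Literature.NumberTheory.LFunctions.Dwork.traceNumber_eq_tsum_coeff`:
  `traceNumber p q G s = ∑_u [X^{(qˢ-1)u}] (∏_{l<s} G(X^{qˡ}))` for `G ∈ R₀`, `q ≥ 2`, `s ≥ 1`
  (`G(X^m) = MvPowerSeries.expand m _ G`).

Ingredients: `ℂ_p` is algebraically closed of characteristic `0`, so `μ_N(ℂ_p)` is cyclic of
order `N` with a primitive root (Mathlib `HasEnoughRootsOfUnity.exists_primitiveRoot`,
`HasEnoughRootsOfUnity.natCard_rootsOfUnity`), character sums over a finite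
group vanish for non-trivial characters (`sum_hom_units`), and the unconditional sums of
`…/DworkRationalityOverconvergentProofs.lean` may be interchanged with finite sums and reindexed.

## References

* N. Koblitz, *p-adic Numbers, p-adic Analysis, and Zeta-Functions*, 2nd ed., GTM 58 (1984),
  Ch. V §3, Lemma 3, pp. 129–130; §4 Ex. 6. [Koblitz1984]
-/

open Filter Finset MvPowerSeries

noncomputable section

namespace Literature.NumberTheory.LFunctions

namespace Dwork

variable {p : ℕ} [Fact p.Prime]

/-! ### Roots of unity in `ℂ_p` and their power sums -/

section RootsOfUnity

variable (p)

/-- Roots of unity of `ℂ_p` have norm `1` (they are the Teichmüller points). [folklore] -/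
theorem norm_rootsOfUnity {N : ℕ} [NeZero N] (ζ : rootsOfUnity N ℂ_[p]) :
    ‖((ζ : ℂ_[p]ˣ) : ℂ_[p])‖ = 1 := by
  have h : ((ζ : ℂ_[p]ˣ) : ℂ_[p]) ^ N = 1 := (mem_rootsOfUnity' N _).mp ζ.2
  have h1 : ‖((ζ : ℂ_[p]ˣ) : ℂ_[p])‖ ^ N = 1 := by rw [← norm_pow, h, norm_one]
  exact (pow_eq_one_iff_of_nonneg (norm_nonneg _) (NeZero.ne N)).mp h1

open Classical in
/-- **Power sums over `μ_N`** (Koblitz, Ch. V §4 Ex. 6: `∑_{ζ^N = 1} ζ^a = N` if `N ∣ a` and `0`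
otherwise): the character `ζ ↦ ζ^a` of the cyclic group `μ_N(ℂ_p)` is trivial iff `N ∣ a`. [cite: Koblitz1984, Ch. V §4 Ex. 6] -/
theorem sum_rootsOfUnity_pow (N : ℕ) [NeZero N] (a : ℕ) :
    ∑ᶠ ζ : rootsOfUnity N ℂ_[p], ((ζ : ℂ_[p]ˣ) : ℂ_[p]) ^ a = if N ∣ a then (N : ℂ_[p]) else 0 := by
  haveI : Fintype (rootsOfUnity N ℂ_[p]) := Fintype.ofFinite _
  rw [finsum_eq_sum_of_fintype]
  -- the character `χ_a : ζ ↦ ζ^a`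
  let χ : rootsOfUnity N ℂ_[p] →* ℂ_[p] :=
    (powMonoidHom a).comp ((Units.coeHom ℂ_[p]).comp (rootsOfUnity N ℂ_[p]).subtype)
  have hχ : ∀ ζ : rootsOfUnity N ℂ_[p], χ ζ = ((ζ : ℂ_[p]ˣ) : ℂ_[p]) ^ a := fun ζ => rfl
  have hsum := sum_hom_units χ
  simp_rw [hχ] at hsum
  rw [hsum]
  -- `χ = 1 ↔ N ∣ a`
  obtain ⟨ζ₀, hζ₀⟩ := HasEnoughRootsOfUnity.exists_primitiveRoot ℂ_[p] N
  have hiff : χ = 1 ↔ N ∣ a := by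
    constructor
    · intro h1
      have := DFunLike.congr_fun h1 (rootsOfUnity.mkOfPowEq ζ₀ hζ₀.pow_eq_one)
      rw [hχ, rootsOfUnity.coe_mkOfPowEq, MonoidHom.one_apply] at this
      exact (hζ₀.pow_eq_one_iff_dvd a).mp this
    · intro hdvd
      ext ζ
      rw [hχ, MonoidHom.one_apply]
      obtain ⟨b, rfl⟩ := hdvd
      rw [pow_mul, (mem_rootsOfUnity' N _).mp ζ.2, one_pow]
  by_cases hdvd : N ∣ a
  · rw [if_pos (hiff.mpr hdvd), if_pos hdvd, ← Nat.card_eq_fintype_card,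
      HasEnoughRootsOfUnity.natCard_rootsOfUnity ℂ_[p] N]
  · rw [if_neg (fun h => hdvd (hiff.mp h)), if_neg hdvd, Nat.cast_zero]

end RootsOfUnity

/-! ### Monomial sums over `μ_N^ι` -/

section MonomialSums

variable {ι : Type*} [Fintype ι]

open Classical in
/-- **`∑_{x ∈ μ_N^ι} x^w = N^{#ι} · [N ∣ w]`** (Koblitz, Ch. V §3, proof of Lemma 3, first display
on p. 130). [cite: Koblitz1984, Ch. V §3 Lemma 3] -/
theorem sum_monomialAt_rootsOfUnity (N : ℕ) [NeZero N] (w : ι →₀ ℕ)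
    [Fintype (rootsOfUnity N ℂ_[p])] :
    ∑ x : ι → rootsOfUnity N ℂ_[p], monomialAt (fun i => ((x i : ℂ_[p]ˣ) : ℂ_[p])) w =
      if ∀ i, N ∣ w i then (N : ℂ_[p]) ^ Fintype.card ι else 0 := by
  simp_rw [monomialAt, Finsupp.prod_pow]
  rw [← Fintype.piFinset_univ, ← Finset.prod_univ_sum (fun _ => Finset.univ)
    (fun i (ζ : rootsOfUnity N ℂ_[p]) => ((ζ : ℂ_[p]ˣ) : ℂ_[p]) ^ w i)]
  have h : ∀ i, ∑ ζ : rootsOfUnity N ℂ_[p], ((ζ : ℂ_[p]ˣ) : ℂ_[p]) ^ w i =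
      if N ∣ w i then (N : ℂ_[p]) else 0 := fun i => by
    rw [← finsum_eq_sum_of_fintype]; exact sum_rootsOfUnity_pow p N (w i)
  simp_rw [h]
  split_ifs with hall
  · rw [Finset.prod_congr rfl fun i _ => if_pos (hall i), prod_const, card_univ]
  · push Not at hall
    obtain ⟨i, hi⟩ := hall
    exact Finset.prod_eq_zero (mem_univ i) (if_neg hi)

end MonomialSums

/-! ### The character-sum half of Koblitz's Lemma 3 -/

section TraceFormula

variable {ι : Type*} [Fintype ι]

/-- `w` is divisible by `N` coordinatewise iff `w = N • u` for some `u`. [folklore] -/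
theorem forall_dvd_iff_exists_smul (N : ℕ) (w : ι →₀ ℕ) :
    (∀ i, N ∣ w i) ↔ ∃ u : ι →₀ ℕ, w = N • u := by
  constructor
  · intro h
    refine ⟨Finsupp.equivFunOnFinite.symm fun i => w i / N, ?_⟩
    ext i
    rw [Finsupp.smul_apply, smul_eq_mul, Finsupp.coe_equivFunOnFinite_symm,
      Nat.mul_div_cancel' (h i)]
  · rintro ⟨u, rfl⟩ i
    exact ⟨u i, by rw [Finsupp.smul_apply, smul_eq_mul]⟩

open Classical in
/-- **The character-sum half of Koblitz's Lemma 3** (Ch. V §3, p. 130, second display: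
`∑_{x^{q-1}=1} G(x) = ∑_w g_w ∑_{x^{q-1}=1} x^w = (q-1)ⁿ ∑_u g_{(q-1)u}`): for `H ∈ R₀` and `N ≥ 1`,
`∑_{x ∈ μ_N^ι} H(x) = N^{#ι} ∑_u h_{N u}` (unconditional sums throughout). [cite: Koblitz1984, Ch. V §3 Lemma 3] -/
theorem sum_evalAt_rootsOfUnity {H : MvPowerSeries ι ℂ_[p]} (hH : IsOverconvergent p H) (N : ℕ)
    [NeZero N] [Fintype (rootsOfUnity N ℂ_[p])] :
    ∑ x : ι → rootsOfUnity N ℂ_[p], evalAt p H (fun i => ((x i : ℂ_[p]ˣ) : ℂ_[p])) =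
      (N : ℂ_[p]) ^ Fintype.card ι * ∑' u : ι →₀ ℕ, coeff (N • u) H := by
  have hx : ∀ (x : ι → rootsOfUnity N ℂ_[p]) (i : ι), ‖((x i : ℂ_[p]ˣ) : ℂ_[p])‖ ≤ 1 :=
    fun x i => (norm_rootsOfUnity p (x i)).le
  -- interchange the finite sum over `x` with the unconditional sum over `w`
  have hswap : ∑ x : ι → rootsOfUnity N ℂ_[p], evalAt p H (fun i => ((x i : ℂ_[p]ˣ) : ℂ_[p])) =
      ∑' w : ι →₀ ℕ, ∑ x : ι → rootsOfUnity N ℂ_[p],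
        coeff w H * monomialAt (fun i => ((x i : ℂ_[p]ˣ) : ℂ_[p])) w :=
    (Summable.tsum_finsetSum fun x _ => hH.summable (hx x)).symm
  rw [hswap]
  simp_rw [← Finset.mul_sum, sum_monomialAt_rootsOfUnity N, mul_ite, mul_zero]
  -- only `w = N • u` contribute
  rw [← tsum_mul_left, ← (nsmul_right_injective (M := ι →₀ ℕ) (NeZero.ne N)).tsum_eq]
  · refine tsum_congr fun u => ?_
    rw [if_pos ((forall_dvd_iff_exists_smul N _).mpr ⟨u, rfl⟩), mul_comm]
  · intro w hw
    rw [Function.mem_support] at hw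
    obtain ⟨u, hu⟩ := (forall_dvd_iff_exists_smul N w).mp (by
      by_contra h
      exact hw (if_neg h))
    exact ⟨u, hu.symm⟩

variable (p) in
open Classical in
/-- **The trace numbers as coefficient sums** (Koblitz, Ch. V §3, Lemma 3 and its proof for
`s > 1`, p. 130): for `G ∈ R₀`, `q ≥ 2` and `s ≥ 1`,
`traceNumber p q G s = ∑_u [X^{(qˢ-1)u}] (G G_q ⋯ G_{q^{s-1}})` — by definition of `traceNumber`
(the normalised sum of `∏_{l<s} G(x^{qˡ})` over `x ∈ μ_{qˢ-1}^ι`), `prod_evalAt_pow_eq` and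
`sum_evalAt_rootsOfUnity`. With the operator-theoretic half of Lemma 3 this is `Tr(Ψˢ)`. [cite: Koblitz1984, Ch. V §3 Lemma 3] -/
theorem traceNumber_eq_tsum_coeff {G : MvPowerSeries ι ℂ_[p]} (hG : IsOverconvergent p G) {q : ℕ}
    (hq : 2 ≤ q) {s : ℕ} (hs : 0 < s) :
    traceNumber p q G s =
      ∑' u : ι →₀ ℕ, coeff ((q ^ s - 1) • u)
        (∏ l ∈ range s, expand (q ^ l) (pow_ne_zero l (show q ≠ 0 by omega)) G) := by
  haveI : NeZero (q ^ s - 1) := ⟨by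
    have : 2 ≤ q ^ s := le_trans hq (Nat.le_self_pow hs.ne' q)
    omega⟩
  haveI : Fintype (rootsOfUnity (q ^ s - 1) ℂ_[p]) := Fintype.ofFinite _
  have hq0 : q ≠ 0 := by omega
  have hx : ∀ (x : ι → rootsOfUnity (q ^ s - 1) ℂ_[p]) (i : ι), ‖((x i : ℂ_[p]ˣ) : ℂ_[p])‖ ≤ 1 :=
    fun x i => (norm_rootsOfUnity p (x i)).le
  have hGs : IsOverconvergent p (∏ l ∈ range s, expand (q ^ l) (pow_ne_zero l hq0) G) :=
    IsOverconvergent.prod _ fun l _ => hG.expand (pow_ne_zero l hq0)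
  rw [traceNumber, finsum_eq_sum_of_fintype]
  simp_rw [prod_evalAt_pow_eq hG hq0 (hx _) s]
  rw [sum_evalAt_rootsOfUnity hGs (q ^ s - 1), ← mul_assoc, inv_mul_cancel₀, one_mul]
  exact pow_ne_zero _ (by exact_mod_cast NeZero.ne (q ^ s - 1))

end TraceFormula

end Dwork

end Literature.NumberTheory.LFunctions
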